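import Mathlib
import HarnessLib
import Literature.Analysis.FluidPDE.MildAncientTimeDecayRegularity
import Literature.Analysis.FluidPDE.AxisymNoSwirlVorticity
import Literature.Analysis.FluidPDE.AxisymHouLiVariables
import Summits.NavierStokesRegularity.NavierStokesRegularity.Theorems.PoloidalWindowDoorLrcModEntireTwistingTHJetOrders

/-!
# Item `LrcModEntire` (stmt-NavierStokesRegularity-20428), skeleton twist_split v6 — T1 cell, step (I): THE JET STUB `stub_flatPlane_badData` BY SIGNATURE

Cell ns-regularity-ideate, seat ns-k2-port-2 g4 (free hand; `--supports stmt-NavierStokesRegularity-20428 --as helper`).  The second stub of the LEAD's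
(ns-poloidal-K2-p3 g13) crux workfile `Cruxes/LrcModEntire/T1StepI.lean` — «the z-jet analysis at a flat thread plane produces bad data» — as a THEOREM with the
stub's signature VERBATIM (`flatPlane_badData`).  Assembly of

* the class inputs: analyticity of the slice `v(−1,·)` (`…LocalSineTubeDoorProfileAlignedWindowRigidityAncient.analyticOnNhd_slice`) and the (F1) derivative bounds
  of every order (`Literature.Analysis.FluidPDE.exists_norm_iteratedFDeriv_le_slice_of_hasTypeITimeDecay`, nsreg-typer p698572);
* (Z) `…TwistingTHJetOrders` (first non-trivial vertical jet `B k₀`, `k₀ ≥ 2` by the flat-plane input `∂₂v₂ = 0`, sign pin, bounds);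
* (S)(T) `…TwistingTHJetStructure` (curl/div structure of the horizontal jets `A j`; leading order `j₁ + k₀` of the global bilinear (TH) identity);
* (P)(E) `…TwistingTHPoincareLemma` + `…TwistingTHJetEndgame.badData_of_planarJets` (and its sign-flipped companion for `N < 0`).

FILL for the workfile: `exact Summit.NavierStokesRegularity.NavierStokesRegularity.Theorems.PoloidalWindowDoorLrcModEntireTwistingTHFlatPlaneBadData.flatPlane_badData`.
With (L3) `…TwistingTHT1HelmholtzOneSigned.helmholtzOneSigned` (p699817) both stubs of `T1StepI.lean` are then theorems: cell T1° (`cellT1_of_stubs`) is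
unconditional, and the registered `stub_twistingTHGerm` ⇐ ⟨27893⟩ ∧ T2b (`stub_twistingTHGerm_of_T1stubs`).

WHAT THIS IS NOT: not a claim about Navier–Stokes regularity; ⟨27893⟩ (`FrequencyGrowthExponent`) and T2b remain hypotheses of the registered stub; the window
hypotheses of the signature are not used by this cell (bears_on LADDER-NS N0, item 20428 / crux 19708; both OPEN).
-/

noncomputable section

-- the summit and its single sub-problem share the name (CONVENTIONS §1), as in every Theorems file
set_option linter.dupNamespace false

namespace Summit.NavierStokesRegularity.NavierStokesRegularity.Theorems.PoloidalWindowDoorLrcModEntireTwistingTHFlatPlaneBadData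

open Set Filter Topology Function Metric InnerProductSpace
open scoped RealInnerProductSpace InnerProductSpace Laplacian ContDiff
open Literature.Analysis Literature.Analysis.FluidPDE
open Summit.NavierStokesRegularity.NavierStokesRegularity.Theorems.LocalSineTubeDoorProfileAlignedWindowRigidityAncient
open Summit.NavierStokesRegularity.NavierStokesRegularity.Theorems.PoloidalWindowDoorLrcModEntireTwistingTHJetStructure
open Summit.NavierStokesRegularity.NavierStokesRegularity.Theorems.PoloidalWindowDoorLrcModEntireTwistingTHJetOrders
open Summit.NavierStokesRegularity.NavierStokesRegularity.Theorems.PoloidalWindowDoorLrcModEntireTwistingTHJetEndgame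

/-- **THE JET STUB `stub_flatPlane_badData` (signature VERBATIM).**  For a profile of the pinned class that is constant on the flat thread plane `{x₂ = 0}` with
`∂₂v₂ = 0` there, satisfies the global bilinear (TH) identity on the planes `{x₂ = z}`, and whose slice `v₂(−1,·)` is NOT identically `v₂(−1,0)`, the z-jet
analysis produces bad data `Φ`. -/
theorem flatPlane_badData :
        ∀ (C : ℝ) (v : ℝ → EuclideanSpace ℝ (Fin 3) → EuclideanSpace ℝ (Fin 3)) (W : Set (ℝ × EuclideanSpace ℝ (Fin 3))),
      (Literature.Analysis.FluidPDE.HasTypeITimeDecay C v ∧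
        ContinuousOn (Function.uncurry v) (Set.Iio (0 : ℝ) ×ˢ Set.univ) ∧
        (∀ s t : ℝ, s < t → t < 0 → ∀ x, v t x =
          Literature.Analysis.UnboundedOperators.heatExtension (v s) (t - s) x -
            Literature.Analysis.FluidPDE.oseenDuhamel 1 s v v t x) ∧
        (∀ t < 0, Literature.Analysis.FluidPDE.VectorCalculus.IsDivFree (v t)) ∧
        (∀ s < 0, ∀ y, ⟪Literature.Analysis.FluidPDE.curl (v s) y, EuclideanSpace.single 2 1⟫_ℝ = 0) ∧
        v (-1) 0 2 ≠ 0 ∧ (∀ t < 0, ∀ x, Real.sqrt (-t) * |v t x 2| ≤ |v (-1) 0 2|) ∧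
        (∀ h : EuclideanSpace ℝ (Fin 3), fderiv ℝ (v (-1)) 0 h 2 = 0) ∧
        (deriv (fun s => v s 0 2) (-1) = v (-1) 0 2 / 2 ∧ v (-1) 0 2 * (Δ (fun y => v (-1) y 2)) 0 ≤ 0)) →
      (IsOpen W ∧ W.Nonempty ∧ W ⊆ Set.Iio (0 : ℝ) ×ˢ Set.univ ∧
        (∀ z ∈ W, (Literature.Analysis.FluidPDE.curl (v z.1) z.2 ≠ 0 ∧
            (fderiv ℝ (v z.1) z.2 (EuclideanSpace.single 0 1) 2 ≠ 0 ∨ fderiv ℝ (v z.1) z.2 (EuclideanSpace.single 1 1) 2 ≠ 0) ∧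
            (fderiv ℝ (v z.1) z.2 (EuclideanSpace.single 2 1) 0 ≠ 0 ∨ fderiv ℝ (v z.1) z.2 (EuclideanSpace.single 2 1) 1 ≠ 0))) ∧
        (∀ m : ℝ → ℝ, ∀ W₁ : Set (ℝ × EuclideanSpace ℝ (Fin 3)), W₁ ⊆ W → IsOpen W₁ → W₁.Nonempty →
            ∃ z ∈ W₁, ∃ b : Fin 3, b ≠ 2 ∧
              fderiv ℝ (v z.1) z.2 (EuclideanSpace.single 2 1) b ≠
                m z.1 * fderiv ℝ (v z.1) z.2 (EuclideanSpace.single b 1) 2) ∧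
        (∀ z ∈ W, (fderiv ℝ (fun x => fderiv ℝ (v z.1) x (EuclideanSpace.single 2 1) 2) z.2 (EuclideanSpace.single 0 1) *
                fderiv ℝ (v z.1) z.2 (EuclideanSpace.single 1 1) 2 -
              fderiv ℝ (fun x => fderiv ℝ (v z.1) x (EuclideanSpace.single 2 1) 2) z.2 (EuclideanSpace.single 1 1) *
                fderiv ℝ (v z.1) z.2 (EuclideanSpace.single 0 1) 2 ≠ 0)) ∧
        (∃ m : ℝ → ℝ → ℝ, ∀ z ∈ W, ∀ b : Fin 3, b ≠ 2 →
            fderiv ℝ (v z.1) z.2 (EuclideanSpace.single 2 1) b =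
              m z.1 (z.2 2) * fderiv ℝ (v z.1) z.2 (EuclideanSpace.single b 1) 2)) →
      (∀ t < 0, ∀ x x' : EuclideanSpace ℝ (Fin 3), x 2 = x' 2 → ∀ b c : Fin 3, b ≠ 2 → c ≠ 2 →
        fderiv ℝ (v t) x (EuclideanSpace.single 2 1) b * fderiv ℝ (v t) x' (EuclideanSpace.single c 1) 2 =
          fderiv ℝ (v t) x' (EuclideanSpace.single 2 1) c * fderiv ℝ (v t) x (EuclideanSpace.single b 1) 2) →
      (∀ y : EuclideanSpace ℝ (Fin 3), y 2 = 0 →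
        v (-1) y = v (-1) 0 ∧ fderiv ℝ (fun x => v (-1) x 2) y (EuclideanSpace.single 2 1) = 0) →
      (∃ x : EuclideanSpace ℝ (Fin 3), v (-1) x 2 ≠ v (-1) 0 2) →
      ∃ Φ : EuclideanSpace ℝ (Fin 3) → ℝ, ContDiff ℝ 3 Φ ∧ (∃ G : ℝ, ∀ x, ‖fderiv ℝ Φ x‖ ≤ G) ∧ (∀ x, 0 ≤ (Δ Φ) x) ∧
        (∃ x, (Δ Φ) x ≠ 0) ∧
        ((∃ L : EuclideanSpace ℝ (Fin 3) →L[ℝ] ℝ, ∀ x, fderiv ℝ (Δ Φ) x = L) ∨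
          (∃ μ₀ : ℝ, ∀ x, fderiv ℝ Φ x = (-μ₀) • fderiv ℝ (Δ Φ) x)) := by
  intro C v W hP _hW hglob hplane hnf
  obtain ⟨hrate, hcont, hmild, hdivf, hpol, hN, hpin, -, -⟩ := hP
  -- the slice `v(−1,·)` is analytic; (F1) bounds
  have hslice : ∀ t < 0, AnalyticOnNhd ℝ (v t) univ := fun t ht => analyticOnNhd_slice hcont (bdd_of_hasTypeITimeDecay hrate) hmild ht
  have hu : AnalyticOnNhd ℝ (v (-1)) univ := hslice (-1) (by norm_num)
  have hwdiv : ∀ t < 0, IsWeaklyDivFree (v t) := fun t ht =>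
    VectorCalculus.IsDivFree.isWeaklyDivFree_holds (hdivf t ht) ((hslice t ht).contDiff (n := 1))
  have hF1 : ∀ k : ℕ, ∃ K : ℝ, ∀ y, ‖iteratedFDeriv ℝ k (v (-1)) y‖ ≤ K := fun k =>
    exists_norm_iteratedFDeriv_le_slice_of_hasTypeITimeDecay hrate hcont hmild hwdiv (by norm_num) k
  -- the planar embedding and the jets
  obtain ⟨ι, hι0, hι1, hι2⟩ := exists_planarEmbedding
  set B : ℕ → EuclideanSpace ℝ (Fin 2) → ℝ := fun k x =>
    iteratedFDeriv ℝ k (fun y => v (-1) y 2) (ι x) (fun _ => EuclideanSpace.single (2 : Fin 3) (1 : ℝ)) with hBdef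
  set A : ℕ → EuclideanSpace ℝ (Fin 2) → EuclideanSpace ℝ (Fin 2) := fun j x =>
    (EuclideanSpace.equiv (Fin 2) ℝ).symm fun i => iteratedFDeriv ℝ (j + 1) (fun y => v (-1) y (Fin.castSucc i)) (ι x)
      (fun _ => EuclideanSpace.single (2 : Fin 3) (1 : ℝ)) with hAdef
  have hB : ∀ k x, B k x = iteratedFDeriv ℝ k (fun y => v (-1) y 2) (ι x) (fun _ => EuclideanSpace.single (2 : Fin 3) (1 : ℝ)) := fun k x => rfl
  have hA : ∀ j x (i : Fin 2), A j x i = iteratedFDeriv ℝ (j + 1) (fun y => v (-1) y (Fin.castSucc i)) (ι x)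
      (fun _ => EuclideanSpace.single (2 : Fin 3) (1 : ℝ)) := fun j x i => by simp [hAdef]
  -- the structural inputs at `t = −1`
  have hcurl : ∀ y, fderiv ℝ (v (-1)) y (EuclideanSpace.single 0 1) 1 = fderiv ℝ (v (-1)) y (EuclideanSpace.single 1 1) 0 := by
    intro y
    have h := hpol (-1) (by norm_num) y
    rw [EuclideanSpace.inner_single_right] at h
    simp only [one_mul, conj_trivial] at h
    rw [curl_apply_two] at h
    linarith
  have hdiv : ∀ y, fderiv ℝ (v (-1)) y (EuclideanSpace.single 0 1) 0 + fderiv ℝ (v (-1)) y (EuclideanSpace.single 1 1) 1 +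
      fderiv ℝ (v (-1)) y (EuclideanSpace.single 2 1) 2 = 0 := fun y => by
    rw [← divergence_eq_sum_three]; exact hdivf (-1) (by norm_num) y
  have hTH := hglob (-1) (by norm_num)
  -- flat plane: `B 0 ≡ N`, `B 1 ≡ 0`
  have hB0 : ∀ x, B 0 x = v (-1) 0 2 := by
    intro x
    show iteratedFDeriv ℝ 0 (fun y => v (-1) y 2) (ι x) (fun _ => EuclideanSpace.single (2 : Fin 3) (1 : ℝ)) = v (-1) 0 2
    rw [iteratedFDeriv_zero_apply, (hplane (ι x) (hι2 x)).1]
  have hB1 : ∀ x, B 1 x = 0 := by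
    intro x
    show iteratedFDeriv ℝ 1 (fun y => v (-1) y 2) (ι x) (fun _ => EuclideanSpace.single (2 : Fin 3) (1 : ℝ)) = 0
    rw [iteratedFDeriv_one_apply]
    exact (hplane (ι x) (hι2 x)).2
  -- (Z) the first non-trivial vertical jet `B k₀`, `k₀ ≥ 2`
  classical
  have hex : ∃ k, 1 ≤ k ∧ ∃ x, B k x ≠ 0 := exists_jetB_ne hu hι0 hι1 hι2 hB hB0 hnf
  obtain ⟨hk₀1, xB, hxB⟩ := Nat.find_spec hex
  have hBvan : ∀ k, 1 ≤ k → k < Nat.find hex → ∀ x, B k x = 0 := by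
    intro k hk1 hk x
    by_contra h
    exact Nat.find_min hex hk ⟨hk1, x, h⟩
  have hk₀2 : 2 ≤ Nat.find hex := by
    by_contra h
    have h1 : Nat.find hex = 1 := by omega
    rw [h1] at hxB
    exact hxB (hB1 xB)
  -- the first non-trivial horizontal jet `A j₁`, `j₁ ≤ k₀ − 2`
  have hdivA : ∀ j x, fderiv ℝ (A j) x (EuclideanSpace.single 0 1) 0 + fderiv ℝ (A j) x (EuclideanSpace.single 1 1) 1 = -B (j + 2) x :=
    div_jetA hu hι0 hι1 hι2 hB hA hdiv
  have hexA : ∃ j, ∃ x, A j x ≠ 0 := by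
    refine ⟨Nat.find hex - 2, ?_⟩
    by_contra hall
    push Not at hall
    have hz : A (Nat.find hex - 2) = fun _ => 0 := funext hall
    have h := hdivA (Nat.find hex - 2) xB
    rw [Nat.sub_add_cancel hk₀2, hz] at h
    simp at h
    exact hxB h
  obtain ⟨xA, hxA⟩ := Nat.find_spec hexA
  have hAvan : ∀ j < Nat.find hexA, ∀ x, A j x = 0 := by
    intro j hj x
    by_contra h
    exact Nat.find_min hexA hj ⟨x, h⟩
  have hj₁le : Nat.find hexA ≤ Nat.find hex - 2 := by
    refine Nat.find_min' hexA ?_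
    by_contra hall
    push Not at hall
    have hz : A (Nat.find hex - 2) = fun _ => 0 := funext hall
    have h := hdivA (Nat.find hex - 2) xB
    rw [Nat.sub_add_cancel hk₀2, hz] at h
    simp at h
    exact hxB h
  -- the planar data
  have ha' : ContDiff ℝ 3 (A (Nat.find hex - 2)) := contDiff_jetA hu hA _
  have hcurl' := curl_jetA hu hι0 hι1 hι2 hA hcurl (Nat.find hex - 2)
  have hdiv' : ∀ x, fderiv ℝ (A (Nat.find hex - 2)) x (EuclideanSpace.single 0 1) 0 +
      fderiv ℝ (A (Nat.find hex - 2)) x (EuclideanSpace.single 1 1) 1 = -B (Nat.find hex) x := by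
    intro x
    have h := hdivA (Nat.find hex - 2) x
    rwa [Nat.sub_add_cancel hk₀2] at h
  obtain ⟨K₁, hK₁⟩ := hF1 (Nat.find hex - 2 + 1)
  have hG : ∀ x, ‖A (Nat.find hex - 2) x‖ ≤ 2 * K₁ := norm_jetA_le hu hA _ hK₁
  obtain ⟨K₂, hK₂⟩ := hF1 (Nat.find hex)
  have hBb : ∀ x, |B (Nat.find hex) x| ≤ K₂ := abs_jetB_le hu hB _ hK₂
  have ha : ContDiff ℝ 1 (A (Nat.find hexA)) := contDiff_jetA hu hA _
  have hlink : A (Nat.find hexA) = A (Nat.find hex - 2) ∨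
      ∀ x, fderiv ℝ (A (Nat.find hexA)) x (EuclideanSpace.single 0 1) 0 + fderiv ℝ (A (Nat.find hexA)) x (EuclideanSpace.single 1 1) 1 = 0 := by
    rcases eq_or_lt_of_le hj₁le with h | h
    · exact Or.inl (by rw [h])
    · refine Or.inr fun x => ?_
      rw [hdivA, hBvan (Nat.find hexA + 2) (by omega) (by omega) x, neg_zero]
  have hTHp := thLeading hu hι0 hι1 hι2 hB hA hTH (j₁ := Nat.find hexA) (k₀ := Nat.find hex) hAvan hB0 hBvan
  -- sign normalisation and the endgame
  have hpin1 : ∀ y, |v (-1) y 2| ≤ |v (-1) 0 2| := fun y => by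
    have h := hpin (-1) (by norm_num) y
    rwa [neg_neg, Real.sqrt_one, one_mul] at h
  rcases lt_or_gt_of_ne hN with hneg | hpos
  · have hmin : ∀ y, v (-1) 0 2 ≤ v (-1) y 2 := fun y => by
      have h := hpin1 y
      rw [abs_of_neg hneg] at h
      linarith [(abs_le.1 h).1]
    have hb_ge : ∀ x, 0 ≤ B (Nat.find hex) x := jetB_nonneg_of_min hu hB hB0 hmin hk₀1 hBvan
    exact badData_of_planarJets_nonneg ha' hcurl' hdiv' hG hb_ge ⟨xB, hxB⟩ hBb ha ⟨xA, hxA⟩ hlink hTHp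
  · have hmax : ∀ y, v (-1) y 2 ≤ v (-1) 0 2 := fun y => by
      have h := hpin1 y; rw [abs_of_pos hpos] at h; exact (le_abs_self _).trans h
    have hb_le : ∀ x, B (Nat.find hex) x ≤ 0 := jetB_nonpos_of_max hu hB hB0 hmax hk₀1 hBvan
    exact badData_of_planarJets ha' hcurl' hdiv' hG hb_le ⟨xB, hxB⟩ hBb ha ⟨xA, hxA⟩ hlink hTHp

end Summit.NavierStokesRegularity.NavierStokesRegularity.Theorems.PoloidalWindowDoorLrcModEntireTwistingTHFlatPlaneBadData
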